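import Summits.BirchSwinnertonDyer.BirchSwinnertonDyer.Theorems.PrintCFramBottomClassIndexLawFiveLeFlipRungSlash
import Summits.BirchSwinnertonDyer.BirchSwinnertonDyer.Theorems.PrintCFramBottomClassIndexLawFiveLeCuspSeedQExpansionPrincipleAtZero
import HarnessLib

set_option autoImplicit false

/-!
# Crux `PrintCFram.BottomClassIndexLawFiveLe` (stmt-BirchSwinnertonDyer-20372), line `eisenstein-resource-bdp-line` (registry v27):
# the typing of `stub_flipRung`, piece T3 file 2/2 — (D) THE COEFFICIENT OF `e(u w/q³)` AT THE FLIPPED CUSP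
# (cell `bsd-print-cfram`, width seat `bsd-line-cfram-p1-w4` g19; THEOREMS ONLY, `--supports` 20372; BSD is not proved by any of this)

HONEST FRAMING. Pure bookkeeping about `q`-series; nothing here is a statement about elliptic curves, Bernoulli numbers or BSD; no
registered stub is closed. Sequel of `…FlipRungSlash` ((A) decomposition, (B) main term, (C) junk periodicity): here the three are
combined into THE COEFFICIENT COROLLARY that T4 (NF-Q transport, w3 g19) and T5 (assembly, w8 g9) consume.

* §1 `eq_zero_of_hasSum_qParam` — a `q`-series `Σ d(K) e(Kw/H)` summing to `0` at every `w ∈ ℍ` has all `d(K) = 0` (uniqueness of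
  q-expansions, read through w8 g8's bare-function `CuspGlue.qExpansion_coeff_unique_of_hasSum` at the ZERO function, whose cusp function
  is `0`); `qParam_vadd_of_period` (`e((x + τ)/H) = e(x/H)·e(τ/H)`); `cexp_div_sq_mul_eq_stdAddChar` (the bridge `e(n·y/q²) = ψ_{q²}(y·n)`
  to T1's `ZMod.stdAddChar` currency, w6 g9 `flipMoment_eq_int`).
* §2 **`coeff_flippedCusp_eq`** — (D): if `(V ∣_k ω₀)(w) = Σ_K g(K) e(Kw/H)` for a period `H = q³·H₁` (T4 takes `H = N`, the `Γ(N)`-level of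
  the vehicle, via `hasSum_qExpansion`) and T1's vanishing `S(n) = 0` for `q ∤ n` holds, then for every `u` with `q ∤ u`:
  **`g(u·H₁) = q⁻²·(q²)^{−k}·c₀(q·u)·S(q·u)`**, `S(n) = Σ_{j unit} h(j) e(n·y(j)/q²)`. Mechanism: by (A) `V ∣_k ω₀ = C·MAIN + JUNK`; by (B)
  and `S(n) = 0` off the multiples of `q`, `MAIN` is a series in `e(w/q³) = e(H₁ w/H)`; by (C) `JUNK(w + q²) = JUNK(w)`, so its coefficients
  `j(K)` satisfy `j(K)·(e(Kq²/H) − 1) = 0` (§1), and `e(u H₁ q²/H) = e(u/q) ≠ 1` for `q ∤ u`. NO holomorphy or boundedness of the junk is used.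
With T1 (`S(qu) = (q/2)(1 + σ·q·J(−u|q))` for the Legendre weights) T4 reads `(1 − q*)·c₀(qu) ∈ p·ℤ̄[1/N]` on the opposite class straight
from NF-Q. beyond-print theorem: NO.

References: [Shimura1971] Prop. 3.64; [DiamondShurman2005] §1.1 (q-expansions), §1.2; crux notes lead-g14 §2.1.
-/

-- summit-side namespace `Summit.BirchSwinnertonDyer.BirchSwinnertonDyer.…` (single-conjunct summit, D-0017 layout)
set_option linter.dupNamespace false

noncomputable section

open scoped MatrixGroups ModularForm Real Classical Topology
open UpperHalfPlane hiding I
open Complex Matrix.GeneralLinearGroup CongruenceSubgroup Function Filter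
open Literature.NumberTheory.EllipticCurves.ModularForms (slash_upperRightHom_apply upperRightHom_smul qParam_vadd)

namespace Summit.BirchSwinnertonDyer.BirchSwinnertonDyer.Theorems.PrintCFram.FlipRung

/-! ## §1 Uniqueness of the coefficients of a `q`-series summing to zero; two small bridges -/

/-- The cusp function of the zero function is zero. [folklore] -/
theorem cuspFunction_const_zero (H : ℝ) : cuspFunction H (fun _ : ℍ ↦ (0 : ℂ)) = 0 := by
  unfold cuspFunction Periodic.cuspFunction
  have h1 : ((fun _ : ℍ ↦ (0 : ℂ)) ∘ ofComplex) ∘ Periodic.invQParam H = fun _ ↦ (0 : ℂ) := rfl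
  rw [h1, (tendsto_const_nhds (x := (0 : ℂ)) (f := 𝓝[≠] (0 : ℂ))).limUnder_eq]
  funext z
  rcases eq_or_ne z 0 with rfl | hz
  · rw [update_self]; rfl
  · rw [update_of_ne hz]; rfl

/-- **Uniqueness of q-expansion coefficients for the zero sum.** If `Σ_K d(K)·e(Kw/H)^1 … ` — precisely
`HasSum (K ↦ d K · 𝕢_H(w)^K) 0` for every `w ∈ ℍ` (`H > 0`) — then every `d(K) = 0`. (The bare-function uniqueness
`CuspGlue.qExpansion_coeff_unique_of_hasSum` at `f = 0`, whose cusp function is `0`, hence analytic, with all Taylor coefficients `0`.)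
[cite: DiamondShurman2005, §1.1] -/
theorem eq_zero_of_hasSum_qParam {H : ℝ} (hH : 0 < H) {d : ℕ → ℂ}
    (h : ∀ w : ℍ, HasSum (fun K : ℕ ↦ d K * Periodic.qParam H (w : ℂ) ^ K) 0) (K : ℕ) : d K = 0 := by
  have han : AnalyticAt ℂ (cuspFunction H (fun _ : ℍ ↦ (0 : ℂ))) 0 := by
    rw [cuspFunction_const_zero]; exact analyticAt_const
  have hf : ∀ τ : ℍ, HasSum (fun m : ℕ ↦ d m • Periodic.qParam H (τ : ℂ) ^ m) ((fun _ : ℍ ↦ (0 : ℂ)) τ) := fun τ ↦ by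
    simpa only [smul_eq_mul] using h τ
  rw [CuspGlue.qExpansion_coeff_unique_of_hasSum hH han hf K, UpperHalfPlane.qExpansion_coeff, cuspFunction_const_zero,
    iteratedDeriv_const_zero, mul_zero]

/-- `𝕢_H(x + τ) = e^{2πi x/H} · 𝕢_H(τ)` (the tree's `qParam_vadd` is the case `H = 1`). [folklore] -/
theorem qParam_vadd_of_period (H x : ℝ) (τ : ℍ) :
    Periodic.qParam H (((x +ᵥ τ : ℍ)) : ℂ) = cexp (2 * π * I * x / H) * Periodic.qParam H (τ : ℂ) := by
  rw [Periodic.qParam, Periodic.qParam, coe_vadd, ← Complex.exp_add]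
  congr 1
  ring

/-- **Bridge to T1's currency.** `e^{2πi (y/q²) n} = ψ_{q²}(y·n)` for the standard additive character `ψ_{q²}` of `ℤ/q²`
(`ZMod.stdAddChar`): the character sum `S(n) = Σ_{j unit} h(j)·e^{2πi (y(j)/q²) n}` of `hasSum_flippedCusp_mainTerm` is w6 g9's
`flipMoment` sum `Σ_{j unit} h(j)·ψ_{q²}(y(j)·n)`. [folklore] -/
theorem cexp_div_sq_mul_eq_stdAddChar {q : ℕ} [NeZero (q ^ 2)] (y : ℤ) (n : ℕ) :
    cexp (2 * π * I * ((y : ℂ) / (q : ℂ) ^ 2) * n) = ZMod.stdAddChar (((y * n : ℤ)) : ZMod (q ^ 2)) := by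
  rw [ZMod.stdAddChar_coe]
  congr 1
  push_cast
  ring

/-! ## §2 (D) The coefficient of `e(u w/q³)`, `q ∤ u`, in `V ∣_k ω₀` -/

/-- **(D) THE COEFFICIENT COROLLARY AT THE FLIPPED CUSP.** Setting of `slash_flippedCusp_decomposition` (prime `q`;
`ω₀ = [a b; M q⁴d₀] ∈ SL₂(ℤ)` with `M ∣ q²d₀ − 1`; the weight-`k` vehicle `F₀`, invariant under every `γ ∈ SL₂(ℤ)` with `Mq² ∣ γ₁₀`,
`M ∣ γ₁₁ − 1`, with `F₀(τ) = Σ c₀(n) e(nτ)`; weights `h`; the twisted form `V(z) = q⁻² Σ_j h(j) F₀(z + j/q²)`; solutions `y, c` of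
`b − y(j)·j·M = q²·c(j)` at the units). Suppose `(V ∣_k ω₀)(w) = Σ_K g(K) e(K w/H)` on `ℍ` for a period `H = q³·H₁` (`H₁ ≥ 1`) and that
the character sum `S(n) = Σ_{j unit} h(j) e(n·y(j)/q²)` vanishes whenever `q ∤ n` (T1). Then for every `u` with `q ∤ u`:
**`g(u·H₁) = q⁻² · (q²)^{−k} · c₀(q·u) · S(q·u)`.** No analytic hypothesis on the junk is used: it is `q²`-periodic ((C)) and has the
expansion `(V ∣_k ω₀) − q⁻²(q²)^{−k}·MAIN`, so its coefficients vanish off the `K` with `e(Kq²/H) = 1`, and `e(u H₁ q²/H) = e(u/q) ≠ 1`.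
[cite: Shimura1971, Prop. 3.64] [cite: DiamondShurman2005, §1.1 and §1.2] -/
theorem coeff_flippedCusp_eq {q : ℕ} [NeZero (q ^ 2)] (hq : q.Prime) (ω₀ : SL(2, ℤ)) {M d₀ : ℤ}
    (hM : ω₀ 1 0 = M) (hD : ω₀ 1 1 = (q : ℤ) ^ 4 * d₀) (hd₀ : M ∣ (q : ℤ) ^ 2 * d₀ - 1)
    {k : ℤ} (F₀ : ℍ → ℂ)
    (hinv : ∀ γ : SL(2, ℤ), M * (q : ℤ) ^ 2 ∣ γ 1 0 → M ∣ γ 1 1 - 1 → F₀ ∣[k] γ = F₀)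
    (c₀ : ℕ → ℂ) (hF₀ : ∀ τ : ℍ, HasSum (fun n : ℕ ↦ c₀ n * Periodic.qParam 1 (τ : ℂ) ^ n) (F₀ τ))
    (h : ZMod (q ^ 2) → ℂ) (V : ℍ → ℂ)
    (hV : ∀ z : ℍ, V z = ((q : ℂ) ^ 2)⁻¹ * ∑ j : ZMod (q ^ 2), h j * F₀ (((j.val : ℝ) / (q : ℝ) ^ 2) +ᵥ z))
    (y c : ZMod (q ^ 2) → ℤ)
    (hyc : ∀ j : ZMod (q ^ 2), IsUnit j → ω₀ 0 1 - y j * (j.val : ℤ) * M = (q : ℤ) ^ 2 * c j)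
    {H₁ : ℕ} (hH₁ : 0 < H₁) (g : ℕ → ℂ)
    (hG : ∀ w : ℍ, HasSum (fun K : ℕ ↦ g K * Periodic.qParam ((q : ℝ) ^ 3 * H₁) (w : ℂ) ^ K) ((V ∣[k] ω₀) w))
    (hS : ∀ n : ℕ, ¬ q ∣ n →
      (∑ j ∈ Finset.univ.filter (fun j : ZMod (q ^ 2) ↦ IsUnit j),
        h j * cexp (2 * π * I * ((y j : ℂ) / (q : ℂ) ^ 2) * n)) = 0)
    (u : ℕ) (hu : ¬ q ∣ u) :
    g (u * H₁) = ((q : ℂ) ^ 2)⁻¹ * ((q : ℂ) ^ 2) ^ (-k) * c₀ (q * u) *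
      ∑ j ∈ Finset.univ.filter (fun j : ZMod (q ^ 2) ↦ IsUnit j),
        h j * cexp (2 * π * I * ((y j : ℂ) / (q : ℂ) ^ 2) * (q * u : ℕ)) := by
  have hq0 : q ≠ 0 := hq.ne_zero
  have hqR : (0 : ℝ) < q := by exact_mod_cast hq.pos
  have hH : (0 : ℝ) < (q : ℝ) ^ 3 * H₁ := by positivity
  set H : ℝ := (q : ℝ) ^ 3 * H₁ with hHdef
  -- notation: the character sum, the constant, the main value, the coefficient sequence of the main term in `e(·/H)`
  set S : ℕ → ℂ := fun n ↦ ∑ j ∈ Finset.univ.filter (fun j : ZMod (q ^ 2) ↦ IsUnit j),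
    h j * cexp (2 * π * I * ((y j : ℂ) / (q : ℂ) ^ 2) * n) with hSdef
  set C : ℂ := ((q : ℂ) ^ 2)⁻¹ * ((q : ℂ) ^ 2) ^ (-k) with hCdef
  set m : ℕ → ℂ := fun K ↦ if H₁ ∣ K then c₀ (q * (K / H₁)) * S (q * (K / H₁)) else 0 with hmdef
  -- the main value and the junk as functions of `w`
  set MAIN : ℍ → ℂ := fun w ↦ ∑ j ∈ Finset.univ.filter (fun j : ZMod (q ^ 2) ↦ IsUnit j),
    h j * F₀ (((y j : ℝ) / (q : ℝ) ^ 2) +ᵥ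
      ((⟨((q : ℝ) ^ 4)⁻¹, by have := hq.pos; positivity⟩ : {x : ℝ // 0 < x}) • w)) with hMAINdef
  set JUNK : ℍ → ℂ := fun w ↦ ((q : ℂ) ^ 2)⁻¹ *
    ∑ j ∈ Finset.univ.filter (fun j : ZMod (q ^ 2) ↦ ¬ IsUnit j),
      h j * (F₀ ∣[k] (upperRightHom ((j.val : ℝ) / (q : ℝ) ^ 2) * (ω₀ : GL (Fin 2) ℝ))) w with hJUNKdef
  -- (A): `V ∣ ω₀ = C · MAIN + JUNK`
  have hA : ∀ w : ℍ, (V ∣[k] ω₀) w = C * MAIN w + JUNK w := fun w ↦ by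
    rw [slash_flippedCusp_decomposition hq ω₀ hM hD hd₀ F₀ hinv h V hV y c hyc w]
  -- (B) re-indexed: `MAIN(w) = Σ_K m(K) e(Kw/H)`
  have hB : ∀ w : ℍ, HasSum (fun K : ℕ ↦ m K * Periodic.qParam H (w : ℂ) ^ K) (MAIN w) := by
    intro w
    have hB0 := hasSum_flippedCusp_mainTerm hq F₀ c₀ hF₀ h y w
    -- drop the terms with `q ∤ n` (they vanish by `hS`) : pass to `n = q n'`
    have hinj : Injective (fun n' : ℕ ↦ q * n') := fun a b hab ↦ Nat.eq_of_mul_eq_mul_left hq.pos hab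
    have hB1 : HasSum ((fun n : ℕ ↦ c₀ n * S n * Periodic.qParam ((q : ℝ) ^ 4) (w : ℂ) ^ n) ∘ fun n' : ℕ ↦ q * n')
        (MAIN w) := by
      refine (hinj.hasSum_iff ?_).mpr hB0
      intro n hn
      have hqn : ¬ q ∣ n := by
        rintro ⟨n', rfl⟩; exact hn ⟨n', rfl⟩
      show c₀ n * S n * Periodic.qParam ((q : ℝ) ^ 4) (w : ℂ) ^ n = 0
      rw [show S n = 0 from hS n hqn, mul_zero, zero_mul]
    -- `e(q n' w/q⁴) = e(n' H₁ w/H)` : pass to `K = n' H₁`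
    have hinj' : Injective (fun n' : ℕ ↦ n' * H₁) := fun a b hab ↦ Nat.eq_of_mul_eq_mul_right hH₁ hab
    refine (hinj'.hasSum_iff ?_).mp ?_
    · intro K hK
      have hK' : ¬ H₁ ∣ K := by
        rintro ⟨t, rfl⟩; exact hK ⟨t, by ring⟩
      show m K * Periodic.qParam H (w : ℂ) ^ K = 0
      rw [hmdef]; simp only [if_neg hK', zero_mul]
    · refine hB1.congr_fun fun n' ↦ ?_
      have hm : m (n' * H₁) = c₀ (q * n') * S (q * n') := by
        rw [hmdef]; simp only [if_pos (dvd_mul_left H₁ n'), Nat.mul_div_cancel n' hH₁]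
      simp only [Function.comp_apply]
      rw [hm]
      congr 1
      rw [Periodic.qParam, Periodic.qParam, ← Complex.exp_nat_mul, ← Complex.exp_nat_mul, hHdef]
      congr 1
      have hqC : (q : ℂ) ≠ 0 := by exact_mod_cast hq0
      have hH₁C : (H₁ : ℂ) ≠ 0 := by exact_mod_cast hH₁.ne'
      push_cast
      field_simp
  -- the junk has the expansion `g − C m` …
  have hJ : ∀ w : ℍ, HasSum (fun K : ℕ ↦ (g K - C * m K) * Periodic.qParam H (w : ℂ) ^ K) (JUNK w) := by
    intro w
    have h1 : JUNK w = (V ∣[k] ω₀) w - C * MAIN w := by rw [hA w]; ring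
    rw [h1]
    have h2 := (hG w).sub ((hB w).mul_left C)
    refine h2.congr_fun fun K ↦ ?_
    ring
  -- … and is `q²`-periodic ((C)), so `(g K − C m K)·(e(K q²/H) − 1) = 0`
  have hJper : ∀ w : ℍ, JUNK ((((q : ℝ) ^ 2) +ᵥ w : ℍ)) = JUNK w := by
    intro w
    simp only [hJUNKdef]
    congr 1
    refine Finset.sum_congr rfl fun j hj ↦ ?_
    rw [Finset.mem_filter] at hj
    congr 1
    rw [← slash_upperRightHom_apply (F₀ ∣[k] (upperRightHom ((j.val : ℝ) / (q : ℝ) ^ 2) * (ω₀ : GL (Fin 2) ℝ))) k,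
      slash_translate_flippedCusp_periodic_of_not_isUnit hq ω₀ hM F₀ hinv hj.2]
  have hvanish : ∀ K : ℕ, (g K - C * m K) * (cexp (2 * π * I * (q : ℝ) ^ 2 / H * K) - 1) = 0 := by
    have hzero : ∀ w : ℍ, HasSum (fun K : ℕ ↦ ((g K - C * m K) * (cexp (2 * π * I * (q : ℝ) ^ 2 / H * K) - 1)) *
        Periodic.qParam H (w : ℂ) ^ K) 0 := by
      intro w
      have h1 := hJ ((((q : ℝ) ^ 2) +ᵥ w : ℍ))
      rw [hJper w] at h1
      have h2 := h1.sub (hJ w)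
      rw [sub_self] at h2
      refine h2.congr_fun fun K ↦ ?_
      rw [qParam_vadd_of_period, mul_pow, ← Complex.exp_nat_mul]
      push_cast
      ring
    intro K
    exact eq_zero_of_hasSum_qParam hH hzero K
  -- at `K = u H₁` the exponential is `e(u/q) ≠ 1`
  have hexp : cexp (2 * π * I * (q : ℝ) ^ 2 / H * (u * H₁ : ℕ)) ≠ 1 := by
    intro h1
    rw [Complex.exp_eq_one_iff] at h1
    obtain ⟨n, hn⟩ := h1
    have hqC : (q : ℂ) ≠ 0 := by exact_mod_cast hq0
    have hH₁C : (H₁ : ℂ) ≠ 0 := by exact_mod_cast hH₁.ne'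
    have hπ : (2 * π * I : ℂ) ≠ 0 := by simp [Real.pi_ne_zero, Complex.I_ne_zero]
    have key : ((u : ℤ) : ℂ) = (n * q : ℤ) := by
      have e1 : 2 * π * I * (q : ℝ) ^ 2 / H * (u * H₁ : ℕ) = (u : ℂ) / q * (2 * π * I) := by
        rw [hHdef]; push_cast; field_simp
      rw [e1] at hn
      have e2 := mul_right_cancel₀ hπ hn
      push_cast
      field_simp at e2
      linear_combination e2
    have key' : (u : ℤ) = n * q := by exact_mod_cast key
    exact hu ⟨n.natAbs, by
      have := congrArg Int.natAbs key'
      simpa [Int.natAbs_mul, Int.natAbs_natCast, mul_comm] using this⟩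
  have hK := hvanish (u * H₁)
  rw [mul_eq_zero, sub_eq_zero] at hK
  rcases hK with hK | hK
  · rw [hK, hmdef]
    simp only [if_pos (dvd_mul_left H₁ u), Nat.mul_div_cancel u hH₁, hSdef, hCdef]
    ring
  · exact absurd (sub_eq_zero.mp hK) hexp

end Summit.BirchSwinnertonDyer.BirchSwinnertonDyer.Theorems.PrintCFram.FlipRung

end
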